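import Summits.QuantumFields.YangMills.Theorems.AllWindowsColdBoxBoxHighLineLandauDivergence
import Summits.QuantumFields.YangMills.Theorems.AllWindowsColdBoxBoxHighLineHodgePoincareBoxSums
import Literature.MathematicalPhysics.QuantumLattice.SU2HaarSmallBall

/-!
# LINE-20 stub U3 `LandauBallUniqueness`, part 3: lattice sums on the cold box

Bookkeeping on the cold box `{0,…,2H}⁴` (edges `boxEdges 4 (2H+1)`, interior sites `interiorSites H = [1, 2H−1]⁴`) for the uniqueness of the
lattice Landau gauge in a small gauge ball (registered stub U3 `stub_landauBallUniqueness` of LINE-20 «landau-rung3», crux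
`AllWindowsColdBox.BoxWindowHighSU2213` ⟨stmt-QuantumFields-24336⟩, parent ⟨stmt-QuantumFields-24004⟩):

* `out_mem_boxEdges`, `in_mem_boxEdges` — the edges `(x, μ)`, `(x − e_μ, μ)` at an interior site are cold-box edges;
* **`sum_inner_div_eq_sum_edges`** — summation by parts: for a site field `φ` (values in `ℍ`) vanishing off the interior and any edge field
  `F`, `Σ_{x interior} ⟪φ x, Σ_μ (F(x,μ) − F(x−e_μ,μ))⟫ = Σ_{e ∈ box} ⟪φ(e₋) − φ(e₊), F e⟫`;
* `sum_sq_le_of_support` / **`sum_norm_sq_le_poincare`** — the discrete Dirichlet Poincaré inequality on the cold box,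
  `Σ_{x interior} ‖φ x‖² ≤ 4H² Σ_{e ∈ box} ‖φ(e₊) − φ(e₋)‖²` (componentwise from the tree's one-axis `HodgePoincare.poincare_line`);
* **`sum_edges_endpoints_le`** — edge multiplicity: `Σ_{e ∈ box} (f(e₋) + f(e₊)) ≤ 8 Σ_{x interior} f x` for `f ≥ 0` vanishing off the interior;
* **`norm_sub_one_le_of_edges`** — the sup bound along axis-0 paths to the frozen layer: if `ψ = 1` off the interior and
  `‖ψ(e₋) − ψ(e₊)‖ ≤ 2r` on every box edge, then `‖ψ x − 1‖ ≤ 4 r H` everywhere.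

Everything proved; no definitions; standard axioms.  HONEST LABEL: helper toward ONE registered stub (U3) of a critic-stamped DRAFT line on
the R2ξ″ crux; no stub is proved by name here, no crux, rung or summit is proved; the Yang–Mills mass gap is NOT proved by this file.
-/

set_option autoImplicit false

noncomputable section

open Finset Quaternion
open Literature.MathematicalPhysics.QuantumFieldTheory.AxialGauge (boxEdges mem_boxEdges mem_boxEdges_iff)
open Literature.Probability.LatticeModels (Site mem_halfOpenBox halfOpenBox)
open Literature.MathematicalPhysics.QuantumLattice (ZdEdge)

namespace Summit.QuantumFields.YangMills.Theorems.AllWindowsColdBoxBoxHighLine.LandauBall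

variable {H : ℕ}

/-! ## Edges at interior sites -/

/-- The edge `(x, μ)` out of an interior site is a cold-box edge. -/
theorem out_mem_boxEdges {x : Site 4} (hx : x ∈ interiorSites H) (μ : Fin 4) : (x, μ) ∈ boxEdges 4 (2 * H + 1) := by
  have hb := interior_bounds hx
  rw [mem_boxEdges_iff]
  refine ⟨fun k => ?_, ?_⟩
  · have := hb k; push_cast; constructor <;> omega
  · have := hb μ; push_cast; omega

/-- The edge `(x − e_μ, μ)` into an interior site is a cold-box edge. -/
theorem in_mem_boxEdges {x : Site 4} (hx : x ∈ interiorSites H) (μ : Fin 4) : (x - Pi.single μ 1, μ) ∈ boxEdges 4 (2 * H + 1) := by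
  have hb := interior_bounds hx
  rw [mem_boxEdges_iff]
  simp only [Pi.sub_apply, Pi.single_apply]
  refine ⟨fun k => ?_, ?_⟩
  · have := hb k; split_ifs <;> push_cast <;> omega
  · have := hb μ; simp only [if_true]; push_cast; omega

/-! ## Summation by parts -/

/-- Sum over box edges of an edge function vanishing unless the BASE point is interior = double sum over interior sites and directions. -/
theorem sum_edges_eq_sum_interior_out {β : Type*} [AddCommMonoid β] (G : ZdEdge 4 → β)
    (hG : ∀ e, e.1 ∉ interiorSites H → G e = 0) :
    ∑ e ∈ boxEdges 4 (2 * H + 1), G e = ∑ x ∈ interiorSites H, ∑ μ : Fin 4, G (x, μ) := by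
  classical
  have hprod : ∑ x ∈ interiorSites H, ∑ μ : Fin 4, G (x, μ) =
      ∑ p ∈ interiorSites H ×ˢ (Finset.univ : Finset (Fin 4)), G p := by
    rw [Finset.sum_product]
  rw [hprod]
  symm
  refine Finset.sum_subset ?_ ?_
  · intro p hp
    rw [Finset.mem_product] at hp
    exact out_mem_boxEdges hp.1 p.2
  · intro e _ he
    exact hG e fun h => he (Finset.mem_product.2 ⟨h, Finset.mem_univ _⟩)

/-- Sum over box edges of an edge function vanishing unless the TIP is interior = double sum over interior sites and incoming directions. -/
theorem sum_edges_eq_sum_interior_in {β : Type*} [AddCommMonoid β] (G : ZdEdge 4 → β)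
    (hG : ∀ e, e.1 + Pi.single e.2 1 ∉ interiorSites H → G e = 0) :
    ∑ e ∈ boxEdges 4 (2 * H + 1), G e = ∑ x ∈ interiorSites H, ∑ μ : Fin 4, G (x - Pi.single μ 1, μ) := by
  classical
  -- reindex the interior double sum by the injection `(x, μ) ↦ (x − e_μ, μ)`
  let τ : Site 4 × Fin 4 ↪ ZdEdge 4 := ⟨fun p => (p.1 - Pi.single p.2 1, p.2), fun p q h => by
    simp only [Prod.mk.injEq] at h
    obtain ⟨h1, h2⟩ := h
    ext1
    · have : p.1 - Pi.single p.2 1 + Pi.single p.2 1 = q.1 - Pi.single q.2 1 + Pi.single q.2 1 := by rw [h1, h2]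
      simpa using this
    · exact h2⟩
  have hprod : ∑ x ∈ interiorSites H, ∑ μ : Fin 4, G (x - Pi.single μ 1, μ) =
      ∑ p ∈ interiorSites H ×ˢ (Finset.univ : Finset (Fin 4)), G (p.1 - Pi.single p.2 1, p.2) := by
    rw [Finset.sum_product]
  rw [hprod]
  have hre : ∑ p ∈ interiorSites H ×ˢ (Finset.univ : Finset (Fin 4)), G (p.1 - Pi.single p.2 1, p.2) =
      ∑ e ∈ (interiorSites H ×ˢ (Finset.univ : Finset (Fin 4))).map τ, G e := by
    rw [Finset.sum_map]
    rfl
  rw [hre]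
  symm
  refine Finset.sum_subset ?_ ?_
  · intro e he
    rw [Finset.mem_map] at he
    obtain ⟨p, hp, rfl⟩ := he
    rw [Finset.mem_product] at hp
    exact in_mem_boxEdges hp.1 p.2
  · intro e _ he
    apply hG e
    intro h
    apply he
    rw [Finset.mem_map]
    refine ⟨(e.1 + Pi.single e.2 1, e.2), Finset.mem_product.2 ⟨h, Finset.mem_univ _⟩, ?_⟩
    change (e.1 + Pi.single e.2 1 - Pi.single e.2 1, e.2) = e
    simp

/-- **Summation by parts on the cold box.**  For a site field `φ` vanishing off the interior and any edge field `F` (values in `ℍ`):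
`Σ_{x interior} ⟪φ x, Σ_μ (F(x,μ) − F(x−e_μ,μ))⟫ = Σ_{e ∈ box} ⟪φ(e₋) − φ(e₊), F e⟫` (`e₋ = e.1`, `e₊ = e.1 + e_{e.2}`). -/
theorem sum_inner_div_eq_sum_edges (φ : Site 4 → ℍ) (hφ : ∀ x, x ∉ interiorSites H → φ x = 0) (F : ZdEdge 4 → ℍ) :
    ∑ x ∈ interiorSites H, inner ℝ (φ x) (∑ μ : Fin 4, (F (x, μ) - F (x - Pi.single μ 1, μ))) =
      ∑ e ∈ boxEdges 4 (2 * H + 1), inner ℝ (φ e.1 - φ (e.1 + Pi.single e.2 1)) (F e) := by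
  have hout := sum_edges_eq_sum_interior_out (H := H) (fun e => inner ℝ (φ e.1) (F e))
    (fun e he => by simp only [hφ _ he, inner_zero_left])
  have hin := sum_edges_eq_sum_interior_in (H := H) (fun e => inner ℝ (φ (e.1 + Pi.single e.2 1)) (F e))
    (fun e he => by simp only [hφ _ he, inner_zero_left])
  simp only [sub_add_cancel] at hin
  simp only [inner_sub_left, Finset.sum_sub_distrib, inner_sum, inner_sub_right]
  rw [hout, hin]

/-! ## The discrete Dirichlet Poincaré inequality on the cold box -/

/-- The closed cube `[0, 2H]⁴` as a `piFinset` IS `halfOpenBox 4 (2H+1)`. -/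
theorem halfOpenBox_eq_piFinset (H : ℕ) :
    halfOpenBox 4 (2 * H + 1) = Fintype.piFinset fun _ : Fin 4 => Finset.Icc (0 : ℤ) (2 * (H : ℤ)) := by
  ext x
  rw [mem_halfOpenBox, HodgePoincare.mem_box]
  refine forall_congr' fun k => ?_
  push_cast
  omega

/-- **Poincaré, scalar form.**  A real site function vanishing off the interior satisfies
`Σ_{x interior} g(x)² ≤ 4H² · Σ_{e ∈ box} (g(e₊) − g(e₋))²`. -/
theorem sum_sq_le_poincare (g : Site 4 → ℝ) (hg : ∀ x, x ∉ interiorSites H → g x = 0) :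
    ∑ x ∈ interiorSites H, g x ^ 2 ≤
      4 * (H : ℝ) ^ 2 * ∑ e ∈ boxEdges 4 (2 * H + 1), (g (e.1 + Pi.single e.2 1) - g e.1) ^ 2 := by
  classical
  set B := Fintype.piFinset fun _ : Fin 4 => Finset.Icc (0 : ℤ) (2 * (H : ℤ)) with hB
  -- support facts
  have hsupp : ∀ x, g x ≠ 0 → (∀ k, (0 : ℤ) ≤ x k ∧ x k ≤ 2 * (H : ℤ)) ∧ 1 ≤ x 0 ∧ x 0 + 1 ≤ ((2 * H : ℕ) : ℤ) := by
    intro x hx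
    have hxI : x ∈ interiorSites H := by
      by_contra h
      exact hx (hg x h)
    have hb := interior_bounds hxI
    refine ⟨fun k => ?_, (hb 0).1, ?_⟩
    · have := hb k; constructor <;> omega
    · have := hb 0; push_cast; omega
  -- Σ_I g² = Σ_B g²
  have hIB : ∑ x ∈ interiorSites H, g x ^ 2 = ∑ x ∈ B, g x ^ 2 := by
    refine HodgePoincare.sum_eq_sum_of_support fun x hx => ?_
    have hx' : g x ≠ 0 := fun h => hx (by rw [h]; ring)
    have hxI : x ∈ interiorSites H := by
      by_contra h
      exact hx' (hg x h)
    refine ⟨fun _ => HodgePoincare.mem_box.2 (hsupp x hx').1, fun _ => hxI⟩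
  rw [hIB]
  have hP := HodgePoincare.poincare_line (a := 0) (b := 2 * (H : ℤ)) le_rfl (2 * H) 0 g hsupp
  -- the axis-0 differences over `B` are among the box-edge differences
  have hdiff : ∑ x ∈ B, (g (x + Pi.single 0 1) - g x) ^ 2 ≤
      ∑ e ∈ boxEdges 4 (2 * H + 1), (g (e.1 + Pi.single e.2 1) - g e.1) ^ 2 := by
    -- drop the far layer `x 0 = 2H` (both values vanish there), then embed `x ↦ (x, 0)`
    have hS : ∑ x ∈ B, (g (x + Pi.single 0 1) - g x) ^ 2 =
        ∑ x ∈ B.filter (fun x => x 0 < 2 * (H : ℤ)), (g (x + Pi.single 0 1) - g x) ^ 2 := by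
      rw [Finset.sum_filter]
      refine Finset.sum_congr rfl fun x hx => ?_
      split_ifs with h
      · rfl
      · have hx0 : x 0 = 2 * (H : ℤ) := by
          have := (HodgePoincare.mem_box.1 hx 0).2; omega
        have h1 : g x = 0 := by
          by_contra hne
          have := (hsupp x hne).2.2; push_cast at this; omega
        have h2 : g (x + Pi.single 0 1) = 0 := by
          by_contra hne
          have := (hsupp _ hne).2.2
          simp only [Pi.add_apply, Pi.single_eq_same] at this; push_cast at this; omega
        rw [h1, h2]; ring
    rw [hS]
    let ι : Site 4 ↪ ZdEdge 4 := ⟨fun x => (x, (0 : Fin 4)), fun x y h => by simpa using h⟩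
    have hmap : ∑ x ∈ B.filter (fun x => x 0 < 2 * (H : ℤ)), (g (x + Pi.single 0 1) - g x) ^ 2 =
        ∑ e ∈ (B.filter (fun x => x 0 < 2 * (H : ℤ))).map ι, (g (e.1 + Pi.single e.2 1) - g e.1) ^ 2 := by
      rw [Finset.sum_map]; rfl
    rw [hmap]
    refine Finset.sum_le_sum_of_subset_of_nonneg ?_ fun e _ _ => sq_nonneg _
    intro e he
    rw [Finset.mem_map] at he
    obtain ⟨x, hx, rfl⟩ := he
    rw [Finset.mem_filter, HodgePoincare.mem_box] at hx
    change (x, (0 : Fin 4)) ∈ boxEdges 4 (2 * H + 1)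
    rw [mem_boxEdges_iff]
    refine ⟨fun k => ?_, ?_⟩
    · have := hx.1 k; push_cast; constructor <;> omega
    · have := hx.2; push_cast; omega
  calc ∑ x ∈ B, g x ^ 2 ≤ ((2 * H : ℕ) : ℝ) ^ 2 * ∑ x ∈ B, (g (x + Pi.single 0 1) - g x) ^ 2 := hP
    _ ≤ ((2 * H : ℕ) : ℝ) ^ 2 * ∑ e ∈ boxEdges 4 (2 * H + 1), (g (e.1 + Pi.single e.2 1) - g e.1) ^ 2 :=
        mul_le_mul_of_nonneg_left hdiff (sq_nonneg _)
    _ = 4 * (H : ℝ) ^ 2 * ∑ e ∈ boxEdges 4 (2 * H + 1), (g (e.1 + Pi.single e.2 1) - g e.1) ^ 2 := by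
        push_cast; ring

/-- **Poincaré, quaternion form.**  A site field `φ : ℤ⁴ → ℍ` vanishing off the interior satisfies
`Σ_{x interior} ‖φ x‖² ≤ 4H² · Σ_{e ∈ box} ‖φ(e₊) − φ(e₋)‖²`. -/
theorem sum_norm_sq_le_poincare (φ : Site 4 → ℍ) (hφ : ∀ x, x ∉ interiorSites H → φ x = 0) :
    ∑ x ∈ interiorSites H, ‖φ x‖ ^ 2 ≤
      4 * (H : ℝ) ^ 2 * ∑ e ∈ boxEdges 4 (2 * H + 1), ‖φ (e.1 + Pi.single e.2 1) - φ e.1‖ ^ 2 := by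
  have h0 := sum_sq_le_poincare (H := H) (fun x => (φ x).re) (fun x hx => by simp [hφ x hx])
  have h1 := sum_sq_le_poincare (H := H) (fun x => (φ x).imI) (fun x hx => by simp [hφ x hx])
  have h2 := sum_sq_le_poincare (H := H) (fun x => (φ x).imJ) (fun x hx => by simp [hφ x hx])
  have h3 := sum_sq_le_poincare (H := H) (fun x => (φ x).imK) (fun x hx => by simp [hφ x hx])
  simp only [Literature.MathematicalPhysics.QuantumLattice.sq_norm_eq_sum_sq, re_sub, imI_sub, imJ_sub, imK_sub,
    Finset.sum_add_distrib, mul_add] at *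
  linarith

/-! ## Edge multiplicity -/

/-- **Edge multiplicity.**  For `f ≥ 0` vanishing off the interior, `Σ_{e ∈ box} (f(e₋) + f(e₊)) ≤ 8 Σ_{x interior} f x`
(each site is the base of four box edges and the tip of four). -/
theorem sum_edges_endpoints_le (f : Site 4 → ℝ) (hf0 : ∀ x, 0 ≤ f x) (hf : ∀ x, x ∉ interiorSites H → f x = 0) :
    ∑ e ∈ boxEdges 4 (2 * H + 1), (f e.1 + f (e.1 + Pi.single e.2 1)) ≤ 8 * ∑ x ∈ interiorSites H, f x := by
  have hout := sum_edges_eq_sum_interior_out (H := H) (fun e => f e.1) (fun e he => hf _ he)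
  have hin := sum_edges_eq_sum_interior_in (H := H) (fun e => f (e.1 + Pi.single e.2 1)) (fun e he => hf _ he)
  simp only [sub_add_cancel] at hin
  rw [Finset.sum_add_distrib, hout, hin]
  simp only [Finset.sum_const, Finset.card_univ, Fintype.card_fin, nsmul_eq_mul, Nat.cast_ofNat]
  rw [← Finset.sum_add_distrib, Finset.mul_sum]
  refine Finset.sum_le_sum fun x _ => ?_
  have := hf0 x
  linarith

/-! ## The sup bound along axis-0 paths -/

/-- **Sup bound.**  If `ψ : ℤ⁴ → ℍ` equals `1` off the interior and `‖ψ(e₋) − ψ(e₊)‖ ≤ 2r` on every cold-box edge (`0 ≤ r`), then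
`‖ψ x − 1‖ ≤ 4 r H` for every `x` (walk down axis `0` to the frozen layer `x₀ = 0`: at most `2H − 1` steps of size `2r`). -/
theorem norm_sub_one_le_of_edges {r : ℝ} (hr : 0 ≤ r) (ψ : Site 4 → ℍ) (hψ : ∀ x, x ∉ interiorSites H → ψ x = 1)
    (hedge : ∀ e ∈ boxEdges 4 (2 * H + 1), ‖ψ e.1 - ψ (e.1 + Pi.single e.2 1)‖ ≤ 2 * r) (x : Site 4) :
    ‖ψ x - 1‖ ≤ 4 * r * H := by
  -- induction on the height `x 0 = n` inside the closed box
  have key : ∀ n : ℕ, (n : ℤ) ≤ 2 * (H : ℤ) → ∀ y : Site 4, (∀ k, (0 : ℤ) ≤ y k ∧ y k ≤ 2 * (H : ℤ)) → y 0 = n →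
      ‖ψ y - 1‖ ≤ 2 * r * n := by
    intro n
    induction n with
    | zero =>
      intro _ y _ hy0
      have hyI : y ∉ interiorSites H := fun h => by have := (interior_bounds h 0).1; omega
      rw [hψ y hyI, sub_self, norm_zero]
      simp
    | succ n ih =>
      intro hn y hy hy0
      set y' : Site 4 := y - Pi.single 0 1 with hy'
      have hy'0 : y' 0 = n := by simp [hy', hy0]
      have hy'k : ∀ k, (0 : ℤ) ≤ y' k ∧ y' k ≤ 2 * (H : ℤ) := by
        intro k
        by_cases hk : k = 0
        · subst hk; rw [hy'0]; constructor <;> omega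
        · have := hy k
          simp only [hy', Pi.sub_apply, Pi.single_eq_of_ne hk, sub_zero]
          exact this
      have hprev := ih (by omega) y' hy'k hy'0
      have he : (y', (0 : Fin 4)) ∈ boxEdges 4 (2 * H + 1) := by
        rw [mem_boxEdges_iff]
        refine ⟨fun k => ?_, ?_⟩
        · have := hy'k k; push_cast; constructor <;> omega
        · rw [hy'0]; push_cast; omega
      have hstep := hedge _ he
      have hyy : y' + Pi.single (0 : Fin 4) 1 = y := by simp [hy']
      simp only [hyy] at hstep
      calc ‖ψ y - 1‖ = ‖(ψ y - ψ y') + (ψ y' - 1)‖ := by rw [sub_add_sub_cancel]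
        _ ≤ ‖ψ y - ψ y'‖ + ‖ψ y' - 1‖ := norm_add_le _ _
        _ ≤ 2 * r + 2 * r * n := by rw [norm_sub_rev]; exact add_le_add hstep hprev
        _ = 2 * r * (n + 1 : ℕ) := by push_cast; ring
  by_cases hx : x ∈ interiorSites H
  · have hb := interior_bounds hx
    have hx0 : 0 ≤ x 0 := by have := hb 0; omega
    obtain ⟨n, hn⟩ : ∃ n : ℕ, x 0 = n := ⟨(x 0).toNat, (Int.toNat_of_nonneg hx0).symm⟩
    have hnle : (n : ℤ) ≤ 2 * (H : ℤ) := by have := hb 0; omega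
    have h := key n hnle x (fun k => by have := hb k; constructor <;> omega) hn
    have hn' : (n : ℝ) ≤ 2 * H := by exact_mod_cast hnle
    calc ‖ψ x - 1‖ ≤ 2 * r * n := h
      _ ≤ 2 * r * (2 * H) := mul_le_mul_of_nonneg_left hn' (by positivity)
      _ = 4 * r * H := by ring
  · rw [hψ x hx, sub_self, norm_zero]
    positivity

end Summit.QuantumFields.YangMills.Theorems.AllWindowsColdBoxBoxHighLine.LandauBall

end
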